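import Literature.AlgebraicGeometry.HodgeTheory.MotivatedClassesDeformation
import Literature.AlgebraicGeometry.HodgeTheory.HyperplaneSectionMonodromyTrivialisations
import Literature.AlgebraicGeometry.Motives.ComplexPointsEhresmann
import Literature.AlgebraicGeometry.Motives.SmoothPiecesByDimension
import Literature.AlgebraicGeometry.Motives.GenericFibre
import Literature.AlgebraicGeometry.Motives.AbstractHodgeTate
import Literature.NumberTheory.Transcendental.AnalytificationSecondCountableProofs
import Mathlib.AlgebraicGeometry.Morphisms.UniversallyOpen
import HarnessLib

/-!
# André's deformation theorem (1996, Thm. 0.5): inputs (A0), (A1), (A4) of the proof of §5.1 on the real carriers — flat sections of `Rᵏ f_* ℂ`, the total space as a smooth quasi-projective irreducible variety, curves on affine pieces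

Family `hodge`, layer `Literature/AlgebraicGeometry/HodgeTheory`. Third proof file of the unit
`Andre1996_deformation` (Y. André, *Pour une théorie inconditionnelle des motifs*, Publ. Math.
IHÉS 83 (1996), Thm. 0.5; named fact in `MotivatedClasses.lean`; proof files
`MotivatedClassesDeformation.lean` — §5.1 assembled as `Andre1996_deformation_of_classical_inputs`
from SIX classical inputs (A0)–(A5) — and `MotivatedClassesTransport.lean`). Three of those inputs
are discharged or reduced to citable published theorems here; everything is PROVED, no named fact.

**(A4) Flat sections** ("`ξ_t = (H_B(j_t^* ∘ j_s^{*-1}))(ξ_s)`", §5.1 p. 25). For a smooth proper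
family `π : 𝒳 ⟶ S` over a smooth base, Voisin (*Hodge Theory I*, Thm. 9.3 and §9.2.1) deduces from
Ehresmann's theorem that `Rᵏ π_* A` is a local system whose stalk at `t` is `Hᵏ(X_t, A)` by
restriction, and (*Hodge Theory II*, §3.1.2, §4.3.1) that the restrictions `A|_{X_t}` of a global
class form a flat section. The tree had every ingredient as a PROVED theorem but not their assembly:
Ehresmann on complex points (`Motives.ComplexPoints.isLocallyTrivialFibration_map_of_smoothOfRelativeDimension`,
`Motives/ComplexPointsEhresmann`), the passage from topological trivialisations to homotopical and
cohomological local triviality (`isHomotopicallyLocallyTrivialOn_of_trivialisations`,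
`IsHomotopicallyLocallyTrivialOn.isCohomologicallyLocallyTrivialOn`,
`HyperplaneSectionMonodromyTrivialisations` / `…Proofs`), and transport in the resulting local system
on the real carriers `complexBetti (fiberOver π t) k` with `transportFun_map_fiberι`
(`DirectImageTransport`).

* `exists_smoothOfRelativeDimension_of_connectedSpace_complexPoints` — a smooth `ℂ`-scheme locally
  of finite type whose complex points form a connected space is smooth of ONE relative dimension
  (the pieces of constant relative dimension, `Motives.exists_smoothPieces`, are open, cover, and are
  disjoint on complex points; non-empty opens have complex points since the scheme is Jacobson);
* `isHomotopicallyLocallyTrivialOn_univ`, `isCohomologicallyLocallyTrivialOn_univ` — for `π` proper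
  and smooth of relative dimension `d` over a separated quasi-compact `S` smooth of relative
  dimension `m`: `π` is homotopically / cohomologically locally trivial over ALL of `S(ℂ)` (so the
  local system `localSystemOfRestrict π k _ : Π₁(S(ℂ)) ⥤ Mod_ℂ`, `t ↦ Hᵏ(X_t(ℂ); ℂ)`, of
  `DirectImageTransport` is available unconditionally for such families);
  `isCohomologicallyLocallyTrivialOn_univ_of_isSmoothProjectiveFamily` — the same in the vocabulary
  of the named fact `deligne_globalInvariantCycles` (a smooth projective family over a quasi-projective
  base smooth of pure dimension `d`), i.e. the input `htriv` of
  `isCohomologicallyLocallyTrivialOn_univ_of_trivialisations` (`GlobalInvariantCyclesSectionsProofs`)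
  supplied;
* `transportFun_univ_map_fiberι` — transport along any path takes `A|_{X_s}` to `A|_{X_t}`;
  `complexBetti_map_fiberι_eq_zero_of_eq_zero` — over a base with connected (hence path connected,
  `pathConnectedSpace_complexPoints_of_smoothOfRelativeDimension`) complex points, `A|_{X_s} = 0` at
  one point forces `A|_{X_t} = 0` at every point (transport is linear);
* `Andre1996_deformation_hflat` — the hypothesis `hflat` of `Andre1996_deformation_of_classical_inputs`
  DISCHARGED; `Andre1996_deformation_of_classical_inputs'` — `Andre1996_deformation` from the
  remaining five inputs.

**(A0) The curve lemma on affine pieces only.** `Andre1996_deformation_of_curves`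
(`MotivatedClassesDeformation`) asks for a smooth irreducible quasi-projective `S'` through two
points of an irreducible component of the (possibly non-separated) base `S` itself;
`Andre1996_deformation_of_affine_curves` asks it only inside AFFINE opens (where it is Mumford's
lemma on an affine variety, *Abelian Varieties* §6, plus normalisation): two points of a component
`Z` are joined through a complex point of `Z ∩ U₁ ∩ U₂` (`S` is Jacobson), `U₁, U₂` affine opens,
and motivatedness is carried along each piece by `Andre1996_deformation.propagate_of_hmain` (base
change, `Motives.familyPullback`).

**(A1) The total space** ("Alors `X` est un schéma quasi projectif lisse, et il existe, d'après
H. Hironaka, une compactification lisse `X̄` de `X`", §5.1 p. 25). The hypothesis `hcomp` of the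
assembly asks, for every smooth projective family over a smooth irreducible quasi-projective base,
for an open immersion of the total space into a smooth projective variety. The first sentence is
proved here, reducing `hcomp` to Hironaka's theorem in citable shape:

* `IsQuasiProjectiveOver.of_isClosedImmersion` — closed subschemes of quasi-projective `ℂ`-schemes
  are quasi-projective (open in the scheme-theoretic image in the ambient projective scheme: the
  image of a quasi-compact morphism commutes with flat base change, Stacks 081I, the tree's
  `Motives.isPullback_toImage_of_flat_mono`); `IsQuasiProjectiveOver.projectiveSpace_tensor` —
  `ℙᴺ × S` is quasi-projective for `S` quasi-projective (Segre); hence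
  `IsQuasiProjectiveOver.of_isClosedImmersion_projectiveSpace_tensor` — the total space of a family
  projective in Hartshorne's sense over a quasi-projective base is quasi-projective;
* `irreducibleSpace_of_isSmoothProjectiveFamily` — the total space of a smooth projective family over
  an irreducible base is irreducible (`f` is flat, hence open; the fibres over the closed = complex
  points are irreducible; `S` is Jacobson);
* `Andre1996_deformation_hcomp_of_hironaka` — `hcomp` from `hHir : ∀ m X, X smooth of relative
  dimension m, quasi-projective, irreducible → ∃ X̄ ⊇ X open, X̄ smooth projective of dimension m`
  (the total space is smooth of relative dimension `n + dim S`, quasi-projective and irreducible);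
* `Andre1996_deformation_of_published_inputs` — **`Andre1996_deformation` from five published
  theorems in citable shape**: the curve lemma on affine varieties (A0; Mumford, *Abelian
  Varieties*, §6 Lemma), Hironaka's smooth compactification (A1; Hironaka 1964, Main Thm. I),
  Deligne's théorème de la partie fixe (A2; the tree's named fact `deligne_globalInvariantCycles`),
  André's Thm. 0.4 in its §5.1 form (A3) and Prop. 2.1 (ii) (A5).

## References

* [Andre1996Motifs] Y. André, Pour une théorie inconditionnelle des motifs, Publ. Math. IHÉS 83
  (1996), Thm. 0.5 (p. 8) and §5.1 (p. 25).
* [VoisinHodgeI2002] C. Voisin, Hodge Theory and Complex Algebraic Geometry I, CUP 2002, Thm. 9.3,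
  §9.2.1.
* [VoisinHodgeII2003] C. Voisin, Hodge Theory and Complex Algebraic Geometry II, CUP 2003, §3.1.2,
  §4.3.1.
* [BrockerJanichIDT1982] Th. Bröcker, K. Jänich, Introduction to Differential Topology, (8.12).
* [GortzWedhorn2020] U. Görtz, T. Wedhorn, Algebraic Geometry I, 2nd ed., Thm. 6.28.
* [Hartshorne1977] R. Hartshorne, Algebraic Geometry, GTM 52, Ch. II §4 (p. 103), Ex. 3.11 (d),
  Ex. 4.9; Ch. III Ex. 9.1.
* [StacksProject] The Stacks Project, Tag 081I (scheme-theoretic image and flat base change),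
  Tag 01UA (flat and locally of finite presentation implies universally open).
* [Liu2002] Q. Liu, Algebraic Geometry and Arithmetic Curves, OUP 2002, Ch. 4 Lemma 3.7, Prop. 3.8.
* [Hironaka1964] H. Hironaka, Resolution of singularities of an algebraic variety over a field of
  characteristic zero, Ann. of Math. 79 (1964), Main Theorem I.
* [DeligneHodgeII1971] P. Deligne, Théorie de Hodge II, Publ. Math. IHÉS 40 (1971), Thm. 4.1.1.
-/

noncomputable section

open CategoryTheory CategoryTheory.Limits AlgebraicGeometry MonoidalCategory CartesianMonoidalCategory
open _root_.Topology _root_.Filter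
open Literature.AlgebraicTopology.SingularHomology

namespace Literature.AlgebraicGeometry.HodgeTheory

/-! ### A smooth `ℂ`-scheme with connected complex points is equidimensional -/

section Equidimensional

/-- **A smooth `ℂ`-scheme of finite type whose space of complex points is connected is smooth of ONE
relative dimension.** Mathlib's `Smooth` is "standard smooth of some relative dimension near each
point"; the tree's `Motives.exists_smoothPieces` splits a smooth `E` into the open pieces `E_N` on
which it is smooth of relative dimension `N`, two pieces never sharing a rational point. The sets
`E_N(ℂ)` are then disjoint open subsets of `E(ℂ)` covering it, so if `E(ℂ)` is connected all complex
points lie in one piece `E_{N₀}`; and every other piece is empty, since a non-empty open subset of a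
scheme locally of finite type over `ℂ` contains a closed point (schemes locally of finite type over a
field are Jacobson, Mathlib `LocallyOfFiniteType.jacobsonSpace`), which is a complex point
(`Motives.EsnaultLevineViehweg.exists_algPoints_pt_eq`). Hence `E = E_{N₀}`.
[cite: GortzWedhorn2020, Thm. 6.28 (relative dimension is locally constant)] -/
theorem exists_smoothOfRelativeDimension_of_connectedSpace_complexPoints (E : Motives.SchemeOver ℂ)
    [Smooth E.hom] [LocallyOfFiniteType E.hom] [ConnectedSpace (Motives.ComplexPoints E)] :
    ∃ N : ℕ, SmoothOfRelativeDimension N E.hom := by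
  obtain ⟨piece, hsm, hcov, huniq, -⟩ := Motives.exists_smoothPieces E
  haveI : JacobsonSpace E.left := LocallyOfFiniteType.jacobsonSpace E.hom
  -- every non-empty open of `E` carries a complex point
  have hrat : ∀ U : E.left.Opens, (U : Set E.left).Nonempty →
      ∃ P : Motives.ComplexPoints E, P.pt ∈ U := fun U hU => by
    obtain ⟨y, hyU, hy⟩ := nonempty_inter_closedPoints hU U.isOpen.isLocallyClosed
    obtain ⟨P, rfl⟩ := Motives.EsnaultLevineViehweg.exists_algPoints_pt_eq (X := E) (k := ℂ) hy
    exact ⟨P, hyU⟩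
  obtain ⟨P₀⟩ := (inferInstance : Nonempty (Motives.ComplexPoints E))
  obtain ⟨N₀, hN₀⟩ := hcov P₀.pt
  -- all complex points lie in the piece of `P₀`
  have hopen : ∀ N, IsOpen {P : Motives.ComplexPoints E | P.pt ∈ piece N} := fun N =>
    Motives.AlgPoints.isOpen_setOf_pt_mem (piece N)
  have hall : ∀ P : Motives.ComplexPoints E, P.pt ∈ piece N₀ := by
    have hcompl : {P : Motives.ComplexPoints E | P.pt ∈ piece N₀}ᶜ =
        ⋃ N ∈ {N : ℕ | N ≠ N₀}, {P : Motives.ComplexPoints E | P.pt ∈ piece N} := by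
      ext P
      simp only [Set.mem_compl_iff, Set.mem_setOf_eq, Set.mem_iUnion, exists_prop]
      constructor
      · intro hP
        obtain ⟨N, hN⟩ := hcov P.pt
        exact ⟨N, fun h => hP (h ▸ hN), hN⟩
      · rintro ⟨N, hN, hP⟩ hP₀
        exact hN (huniq P N N₀ hP hP₀)
    have hclopen : IsClopen {P : Motives.ComplexPoints E | P.pt ∈ piece N₀} := by
      refine ⟨?_, hopen N₀⟩
      rw [← isOpen_compl_iff, hcompl]
      exact isOpen_biUnion fun N _ => hopen N
    have huniv := hclopen.eq_univ ⟨P₀, hN₀⟩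
    intro P
    have hP : P ∈ (Set.univ : Set (Motives.ComplexPoints E)) := Set.mem_univ P
    rw [← huniv] at hP
    exact hP
  -- hence the piece of `P₀` is everything
  have htop : piece N₀ = ⊤ := by
    refine top_unique fun x _ => ?_
    obtain ⟨N, hN⟩ := hcov x
    obtain ⟨P, hP⟩ := hrat (piece N) ⟨x, hN⟩
    obtain rfl := huniq P N N₀ hP (hall P)
    exact hN
  refine ⟨N₀, ?_⟩
  have h1 : SmoothOfRelativeDimension N₀ ((⊤ : E.left.Opens).ι ≫ E.hom) := by
    rw [← htop]
    exact hsm N₀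
  have h2 : E.hom = E.left.topIso.inv ≫ ((⊤ : E.left.Opens).ι ≫ E.hom) := by
    rw [Scheme.toIso_inv_ι_assoc]
  rw [h2]
  have h3 : SmoothOfRelativeDimension (0 + N₀) (E.left.topIso.inv ≫ ((⊤ : E.left.Opens).ι ≫ E.hom)) :=
    inferInstance
  rwa [Nat.zero_add] at h3

end Equidimensional

/-! ### Smooth proper families over smooth bases are homotopically locally trivial everywhere -/

section LocalTriviality

variable {𝒳 S : Motives.SchemeOver ℂ}

/-- **Ehresmann ⟹ homotopical local triviality of a smooth proper family over a smooth base**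
(Voisin I, Thm. 9.3 and §9.2.1: "there exists a diffeomorphism `T : 𝒳 ≅ X₀ × B` over `B`" for
`B ∋ 0` a small ball). For `π : 𝒳 ⟶ S` proper and smooth of relative dimension `d` over a separated
quasi-compact `S` smooth of relative dimension `m` and locally of finite type over `ℂ`: every point
of `S(ℂ)` has arbitrarily small open neighbourhoods `B` such that each fibre inclusion
`X_s(ℂ) ↪ π⁻¹B(ℂ)`, `s ∈ B`, underlies a homotopy equivalence (`IsHomotopicallyLocallyTrivialOn π univ`).
Assembly of PROVED tree theorems: the topological local trivialisations of `π(ℂ)` are Ehresmann's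
theorem on complex points (`Motives.ComplexPoints.isLocallyTrivialFibration_map_of_smoothOfRelativeDimension`,
Bröcker–Jänich (8.12)), the small contractible opens of the real `2m`-manifold `S(ℂ)` are chart balls
(`exists_isOpen_contractibleSpace_of_chartedSpace`), and the passage to homotopy equivalences is
`isHomotopicallyLocallyTrivialOn_of_trivialisations`; second countability of `𝒳(ℂ)`, `S(ℂ)` is
Serre's (`Motives.ComplexPoints.secondCountableTopology_of_compactSpace_holds`).
[cite: VoisinHodgeI2002, Thm. 9.3 and §9.2.1] [cite: BrockerJanichIDT1982, (8.12)] -/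
theorem isHomotopicallyLocallyTrivialOn_univ (π : 𝒳 ⟶ S) (d m : ℕ)
    [SmoothOfRelativeDimension d π.left] [IsProper π.left] [SmoothOfRelativeDimension m S.hom]
    [LocallyOfFiniteType S.hom] [IsSeparated S.hom] [CompactSpace S.left] :
    IsHomotopicallyLocallyTrivialOn π (Set.univ : Set (Motives.ComplexPoints S)) := by
  haveI : IsSeparated 𝒳.hom := by rw [← Over.w π]; infer_instance
  haveI : LocallyOfFiniteType 𝒳.hom := by rw [← Over.w π]; infer_instance
  haveI : CompactSpace 𝒳.left := QuasiCompact.compactSpace_of_compactSpace π.left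
  haveI : SecondCountableTopology (Motives.ComplexPoints 𝒳) :=
    Motives.ComplexPoints.secondCountableTopology_of_compactSpace_holds 𝒳
  haveI : SecondCountableTopology (Motives.ComplexPoints S) :=
    Motives.ComplexPoints.secondCountableTopology_of_compactSpace_holds S
  have htriv := Motives.ComplexPoints.isLocallyTrivialFibration_map_of_smoothOfRelativeDimension d m π
  letI := Motives.ComplexPoints.chartedSpace S m
  refine isHomotopicallyLocallyTrivialOn_of_trivialisations π
    (fun t _ W hW => exists_isOpen_contractibleSpace_of_chartedSpace (d := 2 * m) t W hW) fun t _ => ?_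
  obtain ⟨V, hVo, htV, φ, hφ⟩ := htriv t
  exact ⟨V, hVo, htV, Set.subset_univ V, _, inferInstance, φ, hφ⟩

/-- **`Rᵏ π_* ℂ` is a local system on all of `S(ℂ)`** for a smooth proper family over a smooth base
(cohomological local triviality by restriction over `univ`: homotopy invariance of singular
cohomology applied to `isHomotopicallyLocallyTrivialOn_univ`; Voisin I §9.2.1 "we deduce that
`Rᵏ π_* A` is a local system … the stalk at `t` is canonically isomorphic to `Hᵏ(X_t, A)` by
restriction"). [cite: VoisinHodgeI2002, §9.2.1 (with Thm. 9.3)] -/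
theorem isCohomologicallyLocallyTrivialOn_univ (π : 𝒳 ⟶ S) (d m : ℕ)
    [SmoothOfRelativeDimension d π.left] [IsProper π.left] [SmoothOfRelativeDimension m S.hom]
    [LocallyOfFiniteType S.hom] [IsSeparated S.hom] [CompactSpace S.left] :
    IsCohomologicallyLocallyTrivialOn π (Set.univ : Set (Motives.ComplexPoints S)) :=
  (isHomotopicallyLocallyTrivialOn_univ π d m).isCohomologicallyLocallyTrivialOn

/-- **`Rᵏ f_* ℂ` is a local system on `S(ℂ)` for a smooth projective family over a quasi-projective
base smooth of pure dimension `d`** — the hypothesis-free form of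
`isCohomologicallyLocallyTrivialOn_univ_of_trivialisations` (`GlobalInvariantCyclesSectionsProofs`),
its input `htriv` (local topological trivialisations of `f(ℂ)`) being Ehresmann's theorem on complex
points (`isHomotopicallyLocallyTrivialOn_univ`). [cite: VoisinHodgeI2002, Thm. 9.3 and §9.2.1] -/
theorem isCohomologicallyLocallyTrivialOn_univ_of_isSmoothProjectiveFamily (f : 𝒳 ⟶ S) {n : ℕ}
    (d : ℕ) (hf : Motives.IsSmoothProjectiveFamily f n) (hS : IsQuasiProjectiveOver S)
    [SmoothOfRelativeDimension d S.hom] :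
    IsCohomologicallyLocallyTrivialOn f (Set.univ : Set (Motives.ComplexPoints S)) := by
  haveI : LocallyOfFiniteType S.hom := hS.locallyOfFiniteType
  haveI : IsSeparated S.hom := hS.isVarietyPair_ofScheme.isSeparated
  haveI : QuasiCompact S.hom := hS.isVarietyPair_ofScheme.quasiCompact
  haveI : CompactSpace S.left := QuasiCompact.compactSpace_of_compactSpace S.hom
  haveI := hf.smoothOfRelativeDimension
  haveI := hf.isProper
  exact isCohomologicallyLocallyTrivialOn_univ f n d

/-- `S(ℂ)` is path connected when it is connected and `S` is smooth of some relative dimension over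
`ℂ` (a connected topological manifold is path connected). [folklore] -/
theorem pathConnectedSpace_complexPoints_of_smoothOfRelativeDimension (S : Motives.SchemeOver ℂ)
    (m : ℕ) [SmoothOfRelativeDimension m S.hom] [LocallyOfFiniteType S.hom]
    [ConnectedSpace (Motives.ComplexPoints S)] : PathConnectedSpace (Motives.ComplexPoints S) := by
  letI := Motives.ComplexPoints.chartedSpace S m
  haveI : LocallyPathConnectedSpace (Motives.ComplexPoints S) :=
    ChartedSpace.locallyPathConnectedSpace (EuclideanSpace ℝ (Fin (2 * m))) (Motives.ComplexPoints S)
  exact pathConnectedSpace_iff_connectedSpace.mpr ‹_›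

/-- **Restrictions of a global class to the fibres are flat: transport along any path takes
`A|_{X_s}` to `A|_{X_t}`** — for `π : 𝒳 ⟶ S` a smooth proper family over a smooth, separated,
quasi-compact base and `A ∈ Hᵏ(𝒳(ℂ); ℂ)`, parallel transport in the local system `Rᵏ π_* ℂ`
(`transportFun` over `univ`, available by `isCohomologicallyLocallyTrivialOn_univ`) along every
homotopy class of paths `γ` from `s` to `t` maps `A|_{X_s}` to `A|_{X_t}` (Voisin II §3.1.2; the easy
half of the theorem of the fixed part, Voisin II §4.3.1). [cite: VoisinHodgeII2003, §3.1.2] -/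
theorem transportFun_univ_map_fiberι (π : 𝒳 ⟶ S) (d m : ℕ)
    [SmoothOfRelativeDimension d π.left] [IsProper π.left] [SmoothOfRelativeDimension m S.hom]
    [LocallyOfFiniteType S.hom] [IsSeparated S.hom] [CompactSpace S.left] (k : ℕ)
    {s t : (Set.univ : Set (Motives.ComplexPoints S))} (γ : Path.Homotopic.Quotient s t)
    (A : complexBetti 𝒳 k) :
    transportFun π k (isCohomologicallyLocallyTrivialOn_univ π d m) γ
        (complexBetti.map (Motives.fiberι π s.1) k A) =
      complexBetti.map (Motives.fiberι π t.1) k A :=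
  transportFun_map_fiberι π k _ γ A

/-- **Identity principle for restrictions of global classes** (flat sections of a local system on a
connected base vanish identically if they vanish at one point): for `π : 𝒳 ⟶ S` proper and smooth
of relative dimension `d` over a separated quasi-compact `S`, smooth of relative dimension `m` and
locally of finite type over `ℂ`, with `S(ℂ)` connected, and `C ∈ Hᵏ(𝒳(ℂ); ℂ)`: if `C|_{X_s} = 0`
for one `s ∈ S(ℂ)` then `C|_{X_t} = 0` for every `t ∈ S(ℂ)` — join `s` to `t` by a path (`S(ℂ)` is a
connected manifold, hence path connected) and transport: `C|_{X_t} = γ_*(C|_{X_s}) = γ_*(0) = 0`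
(`transportFun` is `ℂ`-linear). [cite: VoisinHodgeII2003, §3.1.2] [cite: VoisinHodgeI2002, §9.2.1] -/
theorem complexBetti_map_fiberι_eq_zero_of_eq_zero (π : 𝒳 ⟶ S) (d m : ℕ)
    [SmoothOfRelativeDimension d π.left] [IsProper π.left] [SmoothOfRelativeDimension m S.hom]
    [LocallyOfFiniteType S.hom] [IsSeparated S.hom] [CompactSpace S.left]
    [ConnectedSpace (Motives.ComplexPoints S)] (k : ℕ) (C : complexBetti 𝒳 k)
    (s t : Motives.ComplexPoints S) (hs : complexBetti.map (Motives.fiberι π s) k C = 0) :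
    complexBetti.map (Motives.fiberι π t) k C = 0 := by
  haveI := pathConnectedSpace_complexPoints_of_smoothOfRelativeDimension S m
  set U : Set (Motives.ComplexPoints S) := Set.univ with hU
  let s' : U := ⟨s, Set.mem_univ s⟩
  let t' : U := ⟨t, Set.mem_univ t⟩
  have hcont : Continuous fun x : Motives.ComplexPoints S => (⟨x, Set.mem_univ x⟩ : U) :=
    continuous_id.subtype_mk _
  let γ : Path s' t' := (PathConnectedSpace.somePath s t).map hcont
  have key := transportFun_univ_map_fiberι π d m k (s := s') (t := t') ⟦γ⟧ C
  change transportFun π k _ ⟦γ⟧ (complexBetti.map (Motives.fiberι π s) k C) =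
    complexBetti.map (Motives.fiberι π t) k C at key
  rw [hs, ← transportLinear_apply, map_zero] at key
  exact key.symm

end LocalTriviality

/-! ### Quasi-projectivity of closed subschemes and of total spaces -/

section QuasiProjective

variable {X Y S : Motives.SchemeOver ℂ}

/-- **Closed subschemes of quasi-projective `ℂ`-schemes are quasi-projective**: if `c : X ⟶ Y` is a
closed immersion and `j : Y ⟶ P` an open immersion into a projective `P`, then `X` is an open
subscheme of the scheme-theoretic image `Z ⊆ P` of `X → P` (a closed subscheme of `P`, hence
projective): `X = Z ×_P Y` because the formation of the scheme-theoretic image of the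
quasi-compact `X → P` commutes with the flat base change `j` (Stacks 081I, the tree's
`Motives.isPullback_toImage_of_flat_mono`) and `X` is closed in `Y` (Hartshorne II Prop. 7.6 /
Ex. 4.1, "a locally closed subscheme of a projective scheme is quasi-projective").
[cite: Hartshorne1977, Ch. II §4 (quasi-projective morphisms) and Ex. 3.11 (d)] -/
theorem IsQuasiProjectiveOver.of_isClosedImmersion (c : X ⟶ Y) [IsClosedImmersion c.left]
    (hY : IsQuasiProjectiveOver Y) : IsQuasiProjectiveOver X := by
  obtain ⟨P, j, hP, hj⟩ := hY
  haveI := hj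
  -- `Y` is Noetherian (open in the Noetherian `P`), so `j` and `c ≫ j` are quasi-compact
  haveI : IsProper P.hom := hP.isProper
  haveI : IsLocallyNoetherian P.left := LocallyOfFiniteType.isLocallyNoetherian P.hom
  haveI : CompactSpace P.left := QuasiCompact.compactSpace_of_compactSpace P.hom
  haveI : IsNoetherian P.left := {}
  haveI : TopologicalSpace.NoetherianSpace Y.left :=
    j.left.isOpenEmbedding.isInducing.noetherianSpace
  haveI : QuasiCompact j.left := inferInstance
  set γ : X.left ⟶ P.left := c.left ≫ j.left with hγ
  -- the scheme-theoretic image commutes with the flat base change `j`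
  have hsq : IsPullback j.left (𝟙 Y.left) (𝟙 P.left) j.left := IsPullback.of_vert_isIso ⟨by simp⟩
  have key : IsPullback γ.toImage c.left (γ.imageι ≫ 𝟙 P.left) j.left :=
    Motives.isPullback_toImage_of_flat_mono j.left (𝟙 P.left) (𝟙 Y.left) j.left hsq c.left c.left
      (Category.comp_id _)
  haveI : IsOpenImmersion γ.toImage :=
    MorphismProperty.of_isPullback (P := @IsOpenImmersion) key.flip hj
  -- the image `Z ⊆ P` as a projective `ℂ`-scheme and `X ⟶ Z` over `ℂ`
  let Z : Motives.SchemeOver ℂ := Over.mk (γ.imageι ≫ P.hom)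
  let ιZ : Z ⟶ P := Over.homMk γ.imageι rfl
  have hZ : Motives.IsProjectiveOver Z := by
    obtain ⟨n, κ, hκ⟩ := hP
    haveI := hκ
    exact ⟨n, ιZ ≫ κ, inferInstanceAs (IsClosedImmersion (γ.imageι ≫ κ.left))⟩
  have hw : γ.toImage ≫ Z.hom = X.hom := by
    change γ.toImage ≫ γ.imageι ≫ P.hom = X.hom
    rw [Scheme.Hom.toImage_imageι_assoc, hγ, Category.assoc, Over.w j, Over.w c]
  exact ⟨Z, Over.homMk γ.toImage hw, hZ, inferInstanceAs (IsOpenImmersion γ.toImage)⟩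

/-- **`ℙᴺ × S` is quasi-projective for `S` quasi-projective**: `ℙᴺ × S ⟶ ℙᴺ × P` is an open
immersion (base change of `S ↪ P`, `Motives.isPullback_snd_whiskerLeft`) into the projective
`ℙᴺ × P` (Segre, `Motives.IsProjectiveOver.tensor`). [cite: Hartshorne1977, Ch. II Ex. 4.9] -/
theorem IsQuasiProjectiveOver.projectiveSpace_tensor (N : ℕ) (hS : IsQuasiProjectiveOver S) :
    IsQuasiProjectiveOver (Motives.projectiveSpace N ℂ ⊗ S) := by
  obtain ⟨P, j, hP, hj⟩ := hS
  refine ⟨Motives.projectiveSpace N ℂ ⊗ P, Motives.projectiveSpace N ℂ ◁ j,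
    (Motives.isSmoothProjective_projectiveSpace_holds ℂ N).isProjectiveOver.tensor hP, ?_⟩
  have hsq : IsPullback (snd (Motives.projectiveSpace N ℂ) S).left (Motives.projectiveSpace N ℂ ◁ j).left
      j.left (snd (Motives.projectiveSpace N ℂ) P).left :=
    (Motives.isPullback_snd_whiskerLeft j (Motives.projectiveSpace N ℂ)).map (Over.forget _)
  haveI := hj
  exact MorphismProperty.of_isPullback (P := @IsOpenImmersion) hsq hj

/-- **The total space of a family projective in Hartshorne's sense over a quasi-projective base is
quasi-projective** ("`X` est un schéma quasi projectif", André §5.1): `𝒳 ↪ ℙᴺ × S` is closed and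
`ℙᴺ × S` is quasi-projective. [cite: Hartshorne1977, Ch. II §4 (p. 103)] -/
theorem IsQuasiProjectiveOver.of_isClosedImmersion_projectiveSpace_tensor {N : ℕ}
    (ι : X ⟶ Motives.projectiveSpace N ℂ ⊗ S) [IsClosedImmersion ι.left]
    (hS : IsQuasiProjectiveOver S) : IsQuasiProjectiveOver X :=
  IsQuasiProjectiveOver.of_isClosedImmersion ι (hS.projectiveSpace_tensor N)

end QuasiProjective

section Irreducible

variable {n : ℕ} {𝒳 S : Motives.SchemeOver ℂ}

/-- **The total space of a smooth projective family over an irreducible base is irreducible.** For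
`f : 𝒳 ⟶ S` a smooth projective family (smooth, hence flat and open; fibres over the complex points
geometrically irreducible) over an irreducible `S` locally of finite type over `ℂ`: if
`𝒳 = Z₁ ∪ Z₂` with `Zᵢ` closed, the opens `Uᵢ = f(𝒳 ∖ Zᵢ)` do not meet — a common point could be
taken closed (`S` is Jacobson), i.e. a complex point `s`, whose irreducible fibre `X_s ⊆ Z₁ ∪ Z₂`
lies in one `Zᵢ`, contradicting `s ∈ Uᵢ` — so one of them is empty (`S` irreducible), i.e.
`𝒳 = Zᵢ` (the closed-fibre variant of Liu, *Algebraic Geometry and Arithmetic Curves*, Ch. 4,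
Lemma 3.7 and Prop. 3.8: a flat morphism onto an irreducible scheme with irreducible fibres has
irreducible source). [cite: Liu2002, Ch. 4 Lemma 3.7 and Prop. 3.8] -/
theorem irreducibleSpace_of_isSmoothProjectiveFamily (f : 𝒳 ⟶ S)
    (hf : Motives.IsSmoothProjectiveFamily f n) [LocallyOfFiniteType S.hom]
    [IrreducibleSpace S.left] : IrreducibleSpace 𝒳.left := by
  haveI : JacobsonSpace S.left := LocallyOfFiniteType.jacobsonSpace S.hom
  haveI : Smooth f.left := hf.smooth
  have hopen : IsOpenMap f.left.base := f.left.isOpenMap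
  -- the fibre over a complex point, as a subset of `𝒳`, is irreducible
  have hfib : ∀ s : Motives.ComplexPoints S, IsIrreducible (f.left.base ⁻¹' {s.pt}) := fun s => by
    haveI := (hf.isSmoothProjective s).irreducibleSpace
    haveI : Subsingleton ((Motives.specOver ℂ ℂ).left : Type) :=
      inferInstanceAs (Subsingleton (PrimeSpectrum ℂ))
    have hrange : Set.range (Motives.fiberι f s).left.base = f.left.base ⁻¹' {s.pt} := by
      rw [Motives.fiberι_left]
      erw [Scheme.Pullback.range_fst]
      congr 1
      ext x
      simp only [Set.mem_range, Set.mem_singleton_iff]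
      constructor
      · rintro ⟨y, rfl⟩
        rw [Subsingleton.elim y (IsLocalRing.closedPoint ℂ)]
        rfl
      · rintro rfl
        exact ⟨IsLocalRing.closedPoint ℂ, rfl⟩
    rw [← hrange, ← Set.image_univ]
    exact (IrreducibleSpace.isIrreducible_univ _).image _
      (Motives.fiberι f s).left.base.hom.continuous.continuousOn
  -- closed points of `S` are complex points
  have hrat : ∀ U : Set S.left, IsOpen U → U.Nonempty → ∃ s : Motives.ComplexPoints S, s.pt ∈ U :=
    fun U hU hne => by
      obtain ⟨y, hyU, hy⟩ := nonempty_inter_closedPoints hne hU.isLocallyClosed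
      obtain ⟨s, rfl⟩ := Motives.EsnaultLevineViehweg.exists_algPoints_pt_eq (X := S) (k := ℂ) hy
      exact ⟨s, hyU⟩
  -- `𝒳` is non-empty: the fibre over a complex point of the non-empty `S` is non-empty
  haveI : Nonempty 𝒳.left := by
    obtain ⟨s, -⟩ := hrat Set.univ isOpen_univ Set.univ_nonempty
    obtain ⟨x, -⟩ := (hfib s).nonempty
    exact ⟨x⟩
  refine { isPreirreducible_univ := ?_, toNonempty := ‹_› }
  rw [isPreirreducible_iff_isClosed_union_isClosed]
  intro Z₁ Z₂ hZ₁ hZ₂ hcov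
  -- the opens `Uᵢ = f(𝒳 ∖ Zᵢ)` do not meet
  have hdisj : f.left.base '' Z₁ᶜ ∩ f.left.base '' Z₂ᶜ = ∅ := by
    by_contra hne
    obtain ⟨s, ⟨x₁, hx₁, hx₁s⟩, ⟨x₂, hx₂, hx₂s⟩⟩ :=
      hrat _ ((hopen _ hZ₁.isOpen_compl).inter (hopen _ hZ₂.isOpen_compl))
        (Set.nonempty_iff_ne_empty.mpr hne)
    rcases (isPreirreducible_iff_isClosed_union_isClosed.mp (hfib s).isPreirreducible Z₁ Z₂ hZ₁ hZ₂
      fun x _ => hcov (Set.mem_univ x)) with h | h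
    · exact hx₁ (h hx₁s)
    · exact hx₂ (h hx₂s)
  -- hence one of them is empty, as `S` is irreducible
  by_contra hnot
  rw [not_or] at hnot
  obtain ⟨h₁, h₂⟩ := hnot
  have hne₁ : (f.left.base '' Z₁ᶜ).Nonempty := by
    obtain ⟨x, hx⟩ := Set.not_subset.mp h₁
    exact ⟨_, x, hx.2, rfl⟩
  have hne₂ : (f.left.base '' Z₂ᶜ).Nonempty := by
    obtain ⟨x, hx⟩ := Set.not_subset.mp h₂
    exact ⟨_, x, hx.2, rfl⟩
  have := nonempty_preirreducible_inter (hopen _ hZ₁.isOpen_compl) (hopen _ hZ₂.isOpen_compl) hne₁ hne₂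
  rw [hdisj] at this
  exact Set.not_nonempty_empty this

end Irreducible

/-! ### Input (A0): the curve lemma is needed only on affine pieces -/

section AffineCurves

variable {n : ℕ} {𝒳 S S' : Motives.SchemeOver ℂ}

/-- **Propagation along a smooth irreducible quasi-projective base mapping to `S`** (the base-change
step of §5.1: "Puisque la formation de `R²ᵖ f_* ℚ_X(p)` commute à tout changement de base, on peut
remplacer `S` par `S'`"): granted the statement of `Andre1996_deformation` for families over smooth
irreducible quasi-projective bases with connected complex points (`hmain`, as in
`Andre1996_deformation_of_curves`), for every `g : S' ⟶ S` from such an `S'` and `s', t' ∈ S'(ℂ)`,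
if `A|_{𝒳_{g(s')}}` is motivated then so is `A|_{𝒳_{g(t')}}` (base change `𝒳 ×_S S' ⟶ S'`,
`Motives.familyPullback`, and transport of motivated classes along the isomorphisms of fibres,
`map_fiberι_familyPullback_mem_motivatedClasses_iff`; `S'(ℂ)` is connected by SGA1 XII 2.4,
`Motives.ComplexPoints.connectedSpace_iff_holds`). [cite: Andre1996Motifs, §5.1 (p. 25)] -/
theorem Andre1996_deformation.propagate_of_hmain
    (hmain : ∀ ⦃n : ℕ⦄ ⦃𝒳 S : Motives.SchemeOver ℂ⦄ (f : 𝒳 ⟶ S),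
      Motives.IsSmoothProjectiveFamily f n →
      (∃ (N : ℕ) (ι : 𝒳 ⟶ Motives.projectiveSpace N ℂ ⊗ S),
          IsClosedImmersion ι.left ∧ ι ≫ snd (Motives.projectiveSpace N ℂ) S = f) →
      AlgebraicGeometry.Smooth S.hom → IsQuasiProjectiveOver S → IrreducibleSpace S.left →
      ConnectedSpace (Motives.ComplexPoints S) →
      ∀ (p : ℕ) (A : complexBetti 𝒳 (2 * p)) (s t : Motives.ComplexPoints S),
        complexBetti.map (Motives.fiberι f s) (2 * p) A ∈ motivatedClasses n (Motives.fiberOver f s) p →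
        complexBetti.map (Motives.fiberι f t) (2 * p) A ∈ motivatedClasses n (Motives.fiberOver f t) p)
    (f : 𝒳 ⟶ S) (hf : Motives.IsSmoothProjectiveFamily f n)
    (hι : ∃ (N : ℕ) (ι : 𝒳 ⟶ Motives.projectiveSpace N ℂ ⊗ S),
      IsClosedImmersion ι.left ∧ ι ≫ snd (Motives.projectiveSpace N ℂ) S = f)
    (g : S' ⟶ S) (hS'sm : AlgebraicGeometry.Smooth S'.hom) (hS'qp : IsQuasiProjectiveOver S')
    (hS'irr : IrreducibleSpace S'.left) (p : ℕ) (A : complexBetti 𝒳 (2 * p))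
    (s' t' : Motives.ComplexPoints S')
    (hs : complexBetti.map (Motives.fiberι f (Motives.AlgPoints.map g s')) (2 * p) A ∈
      motivatedClasses n (Motives.fiberOver f (Motives.AlgPoints.map g s')) p) :
    complexBetti.map (Motives.fiberι f (Motives.AlgPoints.map g t')) (2 * p) A ∈
      motivatedClasses n (Motives.fiberOver f (Motives.AlgPoints.map g t')) p := by
  have hf' := hf.familyPullback_snd g
  haveI : LocallyOfFiniteType S'.hom := hS'qp.locallyOfFiniteType
  haveI : IrreducibleSpace S'.left := hS'irr
  have hconn : ConnectedSpace (Motives.ComplexPoints S') :=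
    (Motives.ComplexPoints.connectedSpace_iff_holds S').2 inferInstance
  exact (map_fiberι_familyPullback_mem_motivatedClasses_iff f hf g p A t').1
    (hmain _ hf' (Motives.exists_isClosedImmersion_familyPullback f g hι) hS'sm hS'qp hS'irr hconn p _
      s' t' ((map_fiberι_familyPullback_mem_motivatedClasses_iff f hf g p A s').2 hs))

/-- **Step (A0) with the curve lemma needed only on AFFINE pieces.** `Andre1996_deformation` follows
from (i) `hcurve`: for an AFFINE `ℂ`-scheme of finite type `S`, a closed irreducible `Z ⊆ S` and
`s, t ∈ S(ℂ)` on `Z`, there are a smooth irreducible quasi-projective `S'`, `g : S' ⟶ S` and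
`s', t' ∈ S'(ℂ)` over `s, t` (an irreducible curve on the affine variety `Z_red` through the two
points, normalised: Mumford, *Abelian Varieties*, §6, Lemma), and (ii) `hmain` (the statement over
smooth irreducible quasi-projective bases with connected complex points). Compared with
`Andre1996_deformation_of_curves` the curve lemma is not asked for the possibly non-separated `S`
itself: for `s, t` on an irreducible component `Z`, choose affine opens `U₁ ∋ s`, `U₂ ∋ t`; the
non-empty locally closed `Z ∩ U₁ ∩ U₂` has a closed point (`S` is Jacobson), i.e. a complex point
`u`; the traces `Z ∩ Uᵢ` are closed irreducible in the affine `Uᵢ` (`IsPreirreducible.preimage`), so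
`hcurve` joins `s` to `u` inside `U₁` and `u` to `t` inside `U₂`, and
`Andre1996_deformation.propagate_of_hmain` carries motivatedness from `s` to `u` to `t`.
[cite: Andre1996Motifs, §5.1 (p. 25)] -/
theorem Andre1996_deformation_of_affine_curves
    (hcurve : ∀ (S : Motives.SchemeOver ℂ), IsAffine S.left → LocallyOfFiniteType S.hom →
      ∀ (Z : Set S.left), IsClosed Z → IsIrreducible Z →
      ∀ (s t : Motives.ComplexPoints S), s.pt ∈ Z → t.pt ∈ Z →
        ∃ (S' : Motives.SchemeOver ℂ) (g : S' ⟶ S) (s' t' : Motives.ComplexPoints S'),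
          AlgebraicGeometry.Smooth S'.hom ∧ IsQuasiProjectiveOver S' ∧ IrreducibleSpace S'.left ∧
            Motives.AlgPoints.map g s' = s ∧ Motives.AlgPoints.map g t' = t)
    (hmain : ∀ ⦃n : ℕ⦄ ⦃𝒳 S : Motives.SchemeOver ℂ⦄ (f : 𝒳 ⟶ S),
      Motives.IsSmoothProjectiveFamily f n →
      (∃ (N : ℕ) (ι : 𝒳 ⟶ Motives.projectiveSpace N ℂ ⊗ S),
          IsClosedImmersion ι.left ∧ ι ≫ snd (Motives.projectiveSpace N ℂ) S = f) →
      AlgebraicGeometry.Smooth S.hom → IsQuasiProjectiveOver S → IrreducibleSpace S.left →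
      ConnectedSpace (Motives.ComplexPoints S) →
      ∀ (p : ℕ) (A : complexBetti 𝒳 (2 * p)) (s t : Motives.ComplexPoints S),
        complexBetti.map (Motives.fiberι f s) (2 * p) A ∈ motivatedClasses n (Motives.fiberOver f s) p →
        complexBetti.map (Motives.fiberι f t) (2 * p) A ∈ motivatedClasses n (Motives.fiberOver f t) p) :
    Andre1996_deformation := by
  refine Andre1996_deformation_of_irreducibleComponents
    fun n 𝒳 S f hf hι _ hft hqc p A Z hZ s t hs ht hAs => ?_
  haveI := hft
  haveI : JacobsonSpace S.left := LocallyOfFiniteType.jacobsonSpace S.hom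
  have hZirr : IsIrreducible Z := hZ.1
  have hZc : IsClosed Z := isClosed_of_mem_irreducibleComponents Z hZ
  -- the step inside one affine open `U` meeting `Z`
  have step : ∀ (U : S.left.Opens), IsAffineOpen U → ∀ (a b : Motives.ComplexPoints S),
      a.pt ∈ U → b.pt ∈ U → a.pt ∈ Z → b.pt ∈ Z →
      complexBetti.map (Motives.fiberι f a) (2 * p) A ∈ motivatedClasses n (Motives.fiberOver f a) p →
      complexBetti.map (Motives.fiberι f b) (2 * p) A ∈ motivatedClasses n (Motives.fiberOver f b) p := by
    intro U hU a b haU hbU haZ hbZ hPa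
    haveI : IsOpenImmersion (Motives.openSubschemeOverι S U).left := inferInstanceAs (IsOpenImmersion U.ι)
    haveI : IsAffine (Motives.openSubschemeOver S U).left := hU
    haveI : LocallyOfFiniteType (Motives.openSubschemeOver S U).hom :=
      inferInstanceAs (LocallyOfFiniteType (U.ι ≫ S.hom))
    -- lift `a`, `b` to `U`
    have hrange : Set.range (Motives.AlgPoints.map (L := ℂ) (Motives.openSubschemeOverι S U)) =
        {Q | Q.pt ∈ U} := by
      rw [Motives.AlgPoints.range_map_of_isOpenImmersion_holds]
      ext Q
      change Q.pt ∈ U.ι.opensRange ↔ Q.pt ∈ U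
      rw [Scheme.Opens.opensRange_ι]
    obtain ⟨a', rfl⟩ : a ∈ Set.range (Motives.AlgPoints.map (L := ℂ) (Motives.openSubschemeOverι S U)) := by
      rw [hrange]; exact haU
    obtain ⟨b', rfl⟩ : b ∈ Set.range (Motives.AlgPoints.map (L := ℂ) (Motives.openSubschemeOverι S U)) := by
      rw [hrange]; exact hbU
    -- the trace `Z ∩ U`, closed and irreducible in `U`
    have hZU : IsIrreducible (U.ι.base ⁻¹' Z) :=
      ⟨⟨a'.pt, haZ⟩, hZirr.isPreirreducible.preimage U.ι.isOpenEmbedding⟩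
    obtain ⟨S', g, a'', b'', hsm, hqp, hirr, ha'', hb''⟩ :=
      hcurve (Motives.openSubschemeOver S U) inferInstance inferInstance (U.ι.base ⁻¹' Z)
        (hZc.preimage U.ι.continuous) hZU a' b' haZ hbZ
    have key := Andre1996_deformation.propagate_of_hmain hmain f hf hι
      (g ≫ Motives.openSubschemeOverι S U) hsm hqp hirr p A a'' b''
      (by rwa [Motives.AlgPoints.map_comp_apply, ha''])
    rwa [Motives.AlgPoints.map_comp_apply, hb''] at key
  -- affine opens around `s` and `t`, and a complex point `u` of `Z` in both
  obtain ⟨U₁, hU₁, hsU₁, -⟩ := exists_isAffineOpen_mem_and_subset (U := ⊤) (x := s.pt) trivial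
  obtain ⟨U₂, hU₂, htU₂, -⟩ := exists_isAffineOpen_mem_and_subset (U := ⊤) (x := t.pt) trivial
  have hne : (Z ∩ ((U₁ : Set S.left) ∩ U₂)).Nonempty :=
    hZirr.isPreirreducible _ _ U₁.isOpen U₂.isOpen ⟨s.pt, hs, hsU₁⟩ ⟨t.pt, ht, htU₂⟩
  obtain ⟨y, ⟨hyZ, hyU₁, hyU₂⟩, hy⟩ := nonempty_inter_closedPoints hne
    (hZc.isLocallyClosed.inter (U₁.isOpen.inter U₂.isOpen).isLocallyClosed)
  obtain ⟨u, rfl⟩ := Motives.EsnaultLevineViehweg.exists_algPoints_pt_eq (X := S) (k := ℂ) hy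
  exact step U₂ hU₂ u t hyU₂ htU₂ hyZ ht (step U₁ hU₁ s u hsU₁ hyU₁ hs hyZ hAs)

end AffineCurves

/-! ### Input (A4) of André's proof of the deformation theorem, discharged -/

section Andre

/-- **Input (A4) of André's proof of Théorème 0.5 (§5.1), PROVED**: for a smooth projective family
`f : 𝒳 ⟶ S` over a smooth quasi-projective `S` with `S(ℂ)` connected, the restrictions of a global
class `C ∈ Hᵏ(𝒳(ℂ); ℂ)` to the fibres vanish at every point of `S(ℂ)` as soon as they vanish at one
("`ξ_t = (H_B(j_t^* ∘ j_s^{*-1}))(ξ_s)`": the restrictions form a flat section of the local system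
`R^k f_* ℂ`). This is exactly the hypothesis `hflat` of `Andre1996_deformation_of_classical_inputs`:
`S` is smooth of one relative dimension (`exists_smoothOfRelativeDimension_of_connectedSpace_complexPoints`),
separated and quasi-compact (quasi-projective), so `complexBetti_map_fiberι_eq_zero_of_eq_zero`
applies. [cite: Andre1996Motifs, §5.1 (p. 25)] [cite: VoisinHodgeII2003, §3.1.2] -/
theorem Andre1996_deformation_hflat ⦃n : ℕ⦄ ⦃𝒳 S : Motives.SchemeOver ℂ⦄ (f : 𝒳 ⟶ S)
    (hf : Motives.IsSmoothProjectiveFamily f n) (hS : AlgebraicGeometry.Smooth S.hom)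
    (hSqp : IsQuasiProjectiveOver S) (hconn : ConnectedSpace (Motives.ComplexPoints S))
    (k : ℕ) (C : complexBetti 𝒳 k) (s t : Motives.ComplexPoints S)
    (hs : complexBetti.map (Motives.fiberι f s) k C = 0) :
    complexBetti.map (Motives.fiberι f t) k C = 0 := by
  haveI := hS
  haveI : LocallyOfFiniteType S.hom := hSqp.locallyOfFiniteType
  haveI : IsSeparated S.hom := hSqp.isVarietyPair_ofScheme.isSeparated
  haveI : QuasiCompact S.hom := hSqp.isVarietyPair_ofScheme.quasiCompact
  haveI : CompactSpace S.left := QuasiCompact.compactSpace_of_compactSpace S.hom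
  haveI := hconn
  obtain ⟨m, hm⟩ := exists_smoothOfRelativeDimension_of_connectedSpace_complexPoints S
  haveI := hm
  haveI := hf.smoothOfRelativeDimension
  haveI := hf.isProper
  exact complexBetti_map_fiberι_eq_zero_of_eq_zero f n m k C s t hs

/-- **André's Théorème 0.5 from FIVE classical inputs** — `Andre1996_deformation_of_classical_inputs`
with its hypothesis `hflat` (A4, flatness of the restrictions of a global class) DISCHARGED by
`Andre1996_deformation_hflat` (Ehresmann's theorem on complex points and transport in the local
system `R²ᵖ f_* ℂ`). Remaining hypotheses, as there: `hcurve` (A0: an irreducible smooth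
quasi-projective curve through two points of an irreducible component), `hcomp` (A1: Hironaka's
smooth compactification), `hD` (A2: the named fact `deligne_globalInvariantCycles`), `h04` (A3: the
semisimple motivated lift of Thm. 0.4), `h21` (A5: Prop. 2.1 (ii), `A_mot` stable under pull-back).
[cite: Andre1996Motifs, Thm. 0.5 (p. 8) and §5.1 (p. 25)] [cite: DeligneHodgeII1971, Théorème 4.1.1] -/
theorem Andre1996_deformation_of_classical_inputs'
    (hcurve : ∀ (S : Motives.SchemeOver ℂ), LocallyOfFiniteType S.hom → QuasiCompact S.hom →
      ∀ Z ∈ irreducibleComponents S.left, ∀ (s t : Motives.ComplexPoints S), s.pt ∈ Z → t.pt ∈ Z →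
        ∃ (S' : Motives.SchemeOver ℂ) (g : S' ⟶ S) (s' t' : Motives.ComplexPoints S'),
          AlgebraicGeometry.Smooth S'.hom ∧ IsQuasiProjectiveOver S' ∧ IrreducibleSpace S'.left ∧
            Motives.AlgPoints.map g s' = s ∧ Motives.AlgPoints.map g t' = t)
    (hcomp : ∀ ⦃n : ℕ⦄ ⦃𝒳 S : Motives.SchemeOver ℂ⦄ (f : 𝒳 ⟶ S),
      Motives.IsSmoothProjectiveFamily f n →
      (∃ (N : ℕ) (ι : 𝒳 ⟶ Motives.projectiveSpace N ℂ ⊗ S),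
          IsClosedImmersion ι.left ∧ ι ≫ snd (Motives.projectiveSpace N ℂ) S = f) →
      AlgebraicGeometry.Smooth S.hom → IsQuasiProjectiveOver S → IrreducibleSpace S.left →
      ∃ (m : ℕ) (Xbar : Motives.SchemeOver ℂ) (i : 𝒳 ⟶ Xbar),
        Motives.IsSmoothProjective m Xbar ∧ IsOpenImmersion i.left)
    (hD : deligne_globalInvariantCycles)
    (h04 : ∀ ⦃m n : ℕ⦄ ⦃Xbar X : Motives.SchemeOver ℂ⦄ (j : X ⟶ Xbar),
      Motives.IsSmoothProjective m Xbar → Motives.IsSmoothProjective n X →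
      ∀ (p : ℕ) (Ā : complexBetti Xbar (2 * p)),
        complexBetti.map j (2 * p) Ā ∈ motivatedClasses n X p →
        ∃ Ā' ∈ motivatedClasses m Xbar p, complexBetti.map j (2 * p) Ā' = complexBetti.map j (2 * p) Ā)
    (h21 : ∀ ⦃m n : ℕ⦄ ⦃Xbar X : Motives.SchemeOver ℂ⦄ (j : X ⟶ Xbar),
      Motives.IsSmoothProjective m Xbar → Motives.IsSmoothProjective n X →
      ∀ (p : ℕ), ∀ Ā' ∈ motivatedClasses m Xbar p,
        complexBetti.map j (2 * p) Ā' ∈ motivatedClasses n X p) :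
    Andre1996_deformation :=
  Andre1996_deformation_of_classical_inputs hcurve hcomp hD h04
    (fun _ _ _ f hf hS hSqp hconn k C s t hs => Andre1996_deformation_hflat f hf hS hSqp hconn k C s t hs)
    h21

end Andre

/-! ### Input (A1) of André's proof from Hironaka's compactification theorem; the assembly -/

section AndreCompactification

variable {n : ℕ} {𝒳 S : Motives.SchemeOver ℂ}

/-- **Input (A1) of André's proof of Théorème 0.5 (§5.1) from Hironaka's theorem in citable shape.**
"Alors `X` est un schéma quasi projectif lisse, et il existe, d'après H. Hironaka, une
compactification lisse `X̄` de `X`": granted `hHir` — every smooth (of relative dimension `m`)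
quasi-projective irreducible `ℂ`-scheme is an open subscheme of a smooth projective variety of
dimension `m` (Hironaka 1964, Main Theorem I, with the projective closure) — the total space `𝒳` of a
smooth projective family of relative dimension `n`, projective in Hartshorne's sense, over a smooth
irreducible quasi-projective `S` has such a compactification: `𝒳` is smooth over `ℂ` of relative
dimension `n + dim S` (`S` is smooth of ONE relative dimension, being irreducible:
`exists_smoothOfRelativeDimension_of_connectedSpace_complexPoints` with SGA1 XII 2.4,
`Motives.ComplexPoints.connectedSpace_iff_holds`), quasi-projective
(`IsQuasiProjectiveOver.of_isClosedImmersion_projectiveSpace_tensor`) and irreducible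
(`irreducibleSpace_of_isSmoothProjectiveFamily`). This is the hypothesis `hcomp` of
`Andre1996_deformation_of_classical_inputs'`. [cite: Andre1996Motifs, §5.1 (p. 25)]
[cite: Hironaka1964, Main Theorem I] -/
theorem Andre1996_deformation_hcomp_of_hironaka
    (hHir : ∀ (m : ℕ) (X : Motives.SchemeOver ℂ), SmoothOfRelativeDimension m X.hom →
      IsQuasiProjectiveOver X → IrreducibleSpace X.left →
      ∃ (Xbar : Motives.SchemeOver ℂ) (i : X ⟶ Xbar),
        Motives.IsSmoothProjective m Xbar ∧ IsOpenImmersion i.left)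
    (f : 𝒳 ⟶ S) (hf : Motives.IsSmoothProjectiveFamily f n)
    (hι : ∃ (N : ℕ) (ι : 𝒳 ⟶ Motives.projectiveSpace N ℂ ⊗ S),
      IsClosedImmersion ι.left ∧ ι ≫ snd (Motives.projectiveSpace N ℂ) S = f)
    (hS : Smooth S.hom) (hSqp : IsQuasiProjectiveOver S) (hSirr : IrreducibleSpace S.left) :
    ∃ (m : ℕ) (Xbar : Motives.SchemeOver ℂ) (i : 𝒳 ⟶ Xbar),
      Motives.IsSmoothProjective m Xbar ∧ IsOpenImmersion i.left := by
  haveI := hS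
  haveI := hSirr
  haveI : LocallyOfFiniteType S.hom := hSqp.locallyOfFiniteType
  haveI : ConnectedSpace (Motives.ComplexPoints S) :=
    (Motives.ComplexPoints.connectedSpace_iff_holds S).2 inferInstance
  obtain ⟨d, hd⟩ := exists_smoothOfRelativeDimension_of_connectedSpace_complexPoints S
  haveI := hd
  haveI := hf.smoothOfRelativeDimension
  have h𝒳sm : SmoothOfRelativeDimension (n + d) 𝒳.hom :=
    Motives.ComplexPoints.smoothOfRelativeDimension_hom_of_hom f n d
  obtain ⟨N, ι, hιc, -⟩ := hι
  haveI := hιc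
  obtain ⟨Xbar, i, hXbar, hi⟩ := hHir (n + d) 𝒳 h𝒳sm
    (IsQuasiProjectiveOver.of_isClosedImmersion_projectiveSpace_tensor ι hSqp)
    (irreducibleSpace_of_isSmoothProjectiveFamily f hf)
  exact ⟨n + d, Xbar, i, hXbar, hi⟩

/-- **André's Théorème 0.5 (`Andre1996_deformation`) from five published theorems in citable shape.**
The §5.1 assembly `Andre1996_deformation_of_inputs` (`MotivatedClassesDeformation`) run over the
bases produced by `Andre1996_deformation_of_affine_curves` (A0), with the compactification supplied
by `Andre1996_deformation_hcomp_of_hironaka` (A1) and the flatness input by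
`Andre1996_deformation_hflat` (A4) — these steps are PROVED in the tree. The remaining hypotheses are
verbatim statements of:
* `hcurve` — (A0) two complex points of a closed irreducible subset of an AFFINE `ℂ`-scheme of
  finite type lie in the image of a smooth irreducible quasi-projective `S'` ("Il existe une variété
  affine lisse connexe `S'` (par exemple une courbe) … tel que l'image de `S'(ℂ)` dans `S(ℂ)`
  contienne `s` et `t`"; Mumford, *Abelian Varieties*, §6, Lemma: any two points of an irreducible
  variety lie on an irreducible curve — here an affine variety — then normalise the curve);
* `hHir` — (A1) Hironaka: a smooth quasi-projective irreducible complex variety is an open subscheme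
  of a smooth projective variety of the same dimension;
* `hD` — (A2) Deligne's théorème de la partie fixe, the tree's named fact `deligne_globalInvariantCycles`;
* `h04` — (A3) André's Thm. 0.4 in the form used in §5.1 ("`ξ_s` provient d'un cycle motivé sur
  `X̄`": a class of `X̄` with motivated pull-back to `X` has the pull-back of a motivated class);
* `h21` — (A5) André's Prop. 2.1 (ii) with p. 15: `A_mot` is stable under pull-backs.
[cite: Andre1996Motifs, Thm. 0.5 (p. 8), Thm. 0.4, Prop. 2.1 and §5.1 (p. 25)]
[cite: Hironaka1964, Main Theorem I] [cite: DeligneHodgeII1971, Théorème 4.1.1] -/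
theorem Andre1996_deformation_of_published_inputs
    (hcurve : ∀ (S : Motives.SchemeOver ℂ), IsAffine S.left → LocallyOfFiniteType S.hom →
      ∀ (Z : Set S.left), IsClosed Z → IsIrreducible Z →
      ∀ (s t : Motives.ComplexPoints S), s.pt ∈ Z → t.pt ∈ Z →
        ∃ (S' : Motives.SchemeOver ℂ) (g : S' ⟶ S) (s' t' : Motives.ComplexPoints S'),
          AlgebraicGeometry.Smooth S'.hom ∧ IsQuasiProjectiveOver S' ∧ IrreducibleSpace S'.left ∧
            Motives.AlgPoints.map g s' = s ∧ Motives.AlgPoints.map g t' = t)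
    (hHir : ∀ (m : ℕ) (X : Motives.SchemeOver ℂ), SmoothOfRelativeDimension m X.hom →
      IsQuasiProjectiveOver X → IrreducibleSpace X.left →
      ∃ (Xbar : Motives.SchemeOver ℂ) (i : X ⟶ Xbar),
        Motives.IsSmoothProjective m Xbar ∧ IsOpenImmersion i.left)
    (hD : deligne_globalInvariantCycles)
    (h04 : ∀ ⦃m n : ℕ⦄ ⦃Xbar X : Motives.SchemeOver ℂ⦄ (j : X ⟶ Xbar),
      Motives.IsSmoothProjective m Xbar → Motives.IsSmoothProjective n X →
      ∀ (p : ℕ) (Ā : complexBetti Xbar (2 * p)),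
        complexBetti.map j (2 * p) Ā ∈ motivatedClasses n X p →
        ∃ Ā' ∈ motivatedClasses m Xbar p, complexBetti.map j (2 * p) Ā' = complexBetti.map j (2 * p) Ā)
    (h21 : ∀ ⦃m n : ℕ⦄ ⦃Xbar X : Motives.SchemeOver ℂ⦄ (j : X ⟶ Xbar),
      Motives.IsSmoothProjective m Xbar → Motives.IsSmoothProjective n X →
      ∀ (p : ℕ), ∀ Ā' ∈ motivatedClasses m Xbar p,
        complexBetti.map j (2 * p) Ā' ∈ motivatedClasses n X p) :
    Andre1996_deformation := by
  refine Andre1996_deformation_of_affine_curves hcurve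
    fun n 𝒳 S f hf hι hSsm hSqp hSirr hSconn p A s t hAs => ?_
  obtain ⟨m, Xbar, i, hXbar, hi⟩ := Andre1996_deformation_hcomp_of_hironaka hHir f hf hι hSsm hSqp hSirr
  haveI := hi
  exact Andre1996_deformation_of_inputs hD f i hf hSqp hSsm hXbar p A s t
    (fun Ā h => h04 (Motives.fiberι f s ≫ i) hXbar (hf.isSmoothProjective s) p Ā h)
    (fun C hC => Andre1996_deformation_hflat f hf hSsm hSqp hSconn (2 * p) C s t hC)
    (fun Ā' h => h21 (Motives.fiberι f t ≫ i) hXbar (hf.isSmoothProjective t) p Ā' h) hAs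

end AndreCompactification

end Literature.AlgebraicGeometry.HodgeTheory

end
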